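import Summits.CriticalPhenomena.PercolationContinuityZ3.Theorems.PercNearOneGluingNoHeavyLowerTailSahiInterpMasks
import Literature.Combinatorics.Sahi2008.Percolation

/-!
# The interpolation leaf test for Sahi's `E_n` on `{0,1}^m`, VI: grid weights and moments

Support file (cell `prim-sahi`, seat `prim-sahi-typer` gen 30; `--supports stmt-CriticalPhenomena-4575`).  Pure proofs + two auxiliary definitions
(`gridP` — the product weight parameters `x/d` of a grid point as points of `[0,1]`; `ptEquiv` — cube points `y < 2^m` ≃ subsets of `Fin m`);
standard axioms, no `sorry`.

* `atomW_eq_prod`, **`atomTab_getD`** — the integer weight numerators of …`SahiInterpCheck` are `d^m · μ_{x/d}(pt m y)`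
  (`Literature.Combinatorics.Sahi2008.bernoulliWeight`);
* **`sum_atomTab_eq_ex`** — `Σ_{y ∈ X} (atomTab)[y] = d^m · E_{μ_{x/d}}(1_X)`; `prod_ind_eq` — products of indicators are indicators of intersections;
* **`momTab_eq_ex`** — the moment table entry of a block `S` is `d^m · E_{μ_{x/d}}(Π_{j∈S} 1_{A_j})`. [this work]
-/

namespace Summit.CriticalPhenomena.PercolationContinuityZ3.Theorems.SahiInterp

open Finset OneCutCert SahiC3Cube NCopyCert SahiSymCube

/-! ## Grid weights and moments -/

open Literature.Combinatorics.Sahi2008 (ex sahiE bernoulliWeight sahiE_comp_perm sahiE_comp_equiv)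
open Literature.Probability.Percolation.BHK2006 (weight)
open Literature.Probability.Percolation.DecisionTree (ind ind_of_mem ind_of_not_mem)

/-- The product weight at the grid point `x/d`. [this work] -/
noncomputable def gridP {m : ℕ} (d : ℕ) (x : Fin m → ℕ) (hx : ∀ i, x i ≤ d) : Fin m → unitInterval :=
  fun i => ⟨(x i : ℝ) / d, div_nonneg (Nat.cast_nonneg _) (Nat.cast_nonneg _), div_le_one_of_le₀ (by exact_mod_cast hx i) (Nat.cast_nonneg _)⟩

/-- `atomW` as a product over `range`. [this work] -/
theorem atomW_eq_prod (d : ℕ) (xN : ℕ → ℕ) (y : ℕ) : ∀ k : ℕ,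
    atomW d xN y k = ∏ i ∈ Finset.range k, (if y.testBit i then (xN i : ℤ) else (d : ℤ) - (xN i : ℤ))
  | 0 => by simp [atomW]
  | k + 1 => by rw [atomW, atomW_eq_prod d xN y k, Finset.prod_range_succ]

/-- **The weight numerators are `d^m ·` the product weight of the corresponding point**: `(atomTab m d x)[y] = d^m · μ_{x/d}(pt m y)`.
[this work] -/
theorem atomTab_getD {m d : ℕ} (hd : 0 < d) (x : Fin m → ℕ) (hx : ∀ i, x i ≤ d) {y : ℕ} (hy : y < 2 ^ m) :
    (((atomTab m d x).getD y 0 : ℤ) : ℝ) = (d : ℝ) ^ m * bernoulliWeight (gridP d x hx) (pt m y) := by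
  classical
  have hd' : (d : ℝ) ≠ 0 := by exact_mod_cast hd.ne'
  unfold atomTab
  rw [getD_ofFn, dif_pos hy, atomW_eq_prod, ← Fin.prod_univ_eq_prod_range]
  simp only [bernoulliWeight, weight, gridP]
  have hm : (d : ℝ) ^ m = ∏ _i : Fin m, (d : ℝ) := by rw [Finset.prod_const, Finset.card_univ, Fintype.card_fin]
  rw [hm, ← Finset.prod_mul_distrib]
  push_cast
  refine Finset.prod_congr rfl fun i _ => ?_
  rw [getD_ofFn, dif_pos i.isLt, Fin.eta]
  have hmem : (i ∈ pt m y) ↔ y.testBit i = true := by simp [pt]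
  by_cases hb : y.testBit i = true
  · rw [if_pos hb, if_pos (hmem.2 hb)]; field_simp
  · rw [if_neg hb, if_neg (fun h => hb (hmem.1 h))]; field_simp

/-- The cube points `y < 2^m` and the subsets of `Fin m` correspond (`pt` / `encS`). [this work] -/
noncomputable def ptEquiv (m : ℕ) : Fin (2 ^ m) ≃ Set (Fin m) where
  toFun y := pt m y
  invFun S := ⟨encS S, encS_lt S⟩
  left_inv y := by
    apply Fin.ext
    refine Nat.eq_of_testBit_eq fun i => ?_
    show (encS (pt m (y : ℕ))).testBit i = (y : ℕ).testBit i
    unfold encS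
    rw [SahiC3Cube.testBit_enc2]
    by_cases hi : i < m
    · rw [dif_pos hi]; simp [pt]
    · rw [dif_neg hi, Nat.testBit_lt_two_pow (lt_of_lt_of_le y.isLt (Nat.pow_le_pow_right (by norm_num) (not_lt.1 hi)))]
  right_inv S := pt_encS S

/-- **Moment numerators**: `Σ_{y < 2^m, y ∈ X} (atomTab m d x)[y] = d^m · E_{μ_{x/d}}(1_X)`. [this work] -/
theorem sum_atomTab_eq_ex {m d : ℕ} (hd : 0 < d) (x : Fin m → ℕ) (hx : ∀ i, x i ≤ d) (X : Set (Set (Fin m))) :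
    ((∑ y ∈ Finset.range (2 ^ m), (if (encA m X).testBit y then (atomTab m d x).getD y 0 else 0) : ℤ) : ℝ) =
      (d : ℝ) ^ m * ex (bernoulliWeight (gridP d x hx)) (ind X) := by
  classical
  rw [ex, Finset.mul_sum, ← Fin.sum_univ_eq_sum_range, ← (ptEquiv m).sum_comp]
  push_cast
  refine Finset.sum_congr rfl fun y _ => ?_
  rw [testBit_encA]
  show _ = (d : ℝ) ^ m * (bernoulliWeight (gridP d x hx) (pt m y) * ind X (pt m y))
  simp only [y.isLt, decide_true, Bool.true_and]
  by_cases hX : pt m y ∈ X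
  · rw [decide_eq_true hX, if_pos rfl, atomTab_getD hd x hx y.isLt, ind_of_mem hX, mul_one]
  · rw [decide_eq_false hX, ind_of_not_mem hX, mul_zero, mul_zero]
    simp

/-- Products of indicators are indicators of intersections. [this work] -/
theorem prod_ind_eq {m n : ℕ} (A : Fin n → Set (Set (Fin m))) (B : Finset (Fin n)) :
    (fun ω => ∏ j ∈ B, ind (A j) ω) = ind (⋂ j ∈ B, A j) := by
  funext ω
  by_cases hω : ω ∈ ⋂ j ∈ B, A j
  · rw [ind_of_mem hω]
    exact Finset.prod_eq_one fun j hj => by rw [ind_of_mem ((Set.mem_iInter₂.1 hω) j hj)]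
  · rw [ind_of_not_mem hω]
    simp only [Set.mem_iInter₂, not_forall] at hω
    obtain ⟨j, hj, hωj⟩ := hω
    exact Finset.prod_eq_zero hj (by rw [ind_of_not_mem hωj])

/-- **Entries of the moment table at a grid point**: for a block `S < 2^n`,
`mom[S] = d^m · E_{μ_{x/d}}(Π_{j ∈ S} 1_{A_j})`. [this work] -/
theorem momTab_eq_ex {m n d : ℕ} (hd : 0 < d) (A : Fin n → Set (Set (Fin m))) (x : Fin m → ℕ) (hx : ∀ i, x i ≤ d)
    {S : ℕ} (hS : S < 2 ^ n) :
    (((momTab n (ptsTab m n (maskTab m n (List.ofFn fun i => encA m (A i)))) (atomTab m d x)).getD S 0 : ℤ) : ℝ) =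
      (d : ℝ) ^ m * ex (bernoulliWeight (gridP d x hx)) (fun ω => ∏ j ∈ bitsF n S, ind (A j) ω) := by
  rw [momTab_getD _ _ hS, maskTab_getD A hS, sum_atomTab_eq_ex hd x hx, prod_ind_eq]

end Summit.CriticalPhenomena.PercolationContinuityZ3.Theorems.SahiInterp
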